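import Summits.ValiantsHypothesis.ValiantsHypothesis.Theorems.LacunarySymmetroidMatrixDescartesLagrangeTowerDefs

/-!
# `MatrixDescartes` census — arrowhead Lagrange tower: windows, sign bookkeeping and the partial-fraction identity

HONEST FRAMING.  Object-search cell `pub-symmetroid`, crux `Theses.LacunarySymmetroid.MatrixDescartes`
(stmt-ValiantsHypothesis-18050); seat val-sym-mdr-p1 (g2).  Part of the kernel port of the cell's THEOREM L (conjb-3 g3, ROUND3-MEMO §1;
paper-checked by conjb-1 g2 and theory g21) in the arrowhead / secular form of `…LagrangeTowerDefs`: for EVERY `m ≥ 1` some real symmetric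
three-term lacunary `m × m` pencil has `C(m+2,2) − 1` distinct positive determinant roots, so `KThreeColumnLaw` (CONJECTURE A3) holds.
This is a LOWER-bound / Descartes-extremality statement for the thin `K = 3` column (CONJECTURE-A currency); it proves nothing about
the crux `MatrixDescartes` (an upper-bound statement at fat formats) and nothing about `VP ≠ VNP`.  No definitions in this file.

THIS FILE. Elementary facts about the windows (`zroot`, nesting of consecutive levels), the sign of `∏_{j ≠ l} (f l − f j)` for a
strictly increasing `f`, and the PARTIAL-FRACTION IDENTITY `Ppoly_eq : P = L·N + Σ_l r_l·N_l` (both sides have degree `≤ k+1` and agree at the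
`k+2` points `ν_0, …, ν_{k−1}, 5, 6` — `Polynomial.eq_of_natDegree_lt_card_of_eval_eq`; no coefficient bookkeeping). [folklore]
-/

-- `Summit.ValiantsHypothesis.ValiantsHypothesis.…` repeats a component by the D-0017 layout
-- (single-conjunct summit), which the `dupNamespace` linter flags; the name is mandated.
set_option linter.dupNamespace false

namespace Summit.ValiantsHypothesis.ValiantsHypothesis.Theorems.LacunarySymmetroidMatrixDescartes.Census.LagrangeTower

open Matrix Polynomial Finset
open scoped BigOperators

/-! ## PROOFS, part I: windows, signs, partial fractions, the secular identity and the alternation of `βnew` -/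

section Windows

/-- `0 < 4^{-k}`. -/
theorem four_inv_pow_pos (k : ℕ) : 0 < ((4 : ℝ)⁻¹) ^ k := by positivity

/-- The designed roots are positive. -/
theorem zroot_pos (k : ℕ) (i : Fin k) : 0 < zroot k i := by
  unfold zroot; positivity

/-- `zroot k i < 2·4^{-k}` (top of window `k`). -/
theorem zroot_lt_two_mul (k : ℕ) (i : Fin k) : zroot k i < 2 * ((4 : ℝ)⁻¹) ^ k := by
  unfold zroot
  have hk : 0 < (k : ℝ) + 1 := by positivity
  have hi : ((i : ℝ) + 1) / ((k : ℝ) + 1) < 1 := by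
    rw [div_lt_one hk]
    have : (i : ℝ) + 1 ≤ k := by exact_mod_cast Nat.succ_le_of_lt i.isLt
    linarith
  nlinarith [four_inv_pow_pos k]

/-- `4^{-k} < zroot k i` (bottom of window `k`). -/
theorem gt_of_zroot (k : ℕ) (i : Fin k) : ((4 : ℝ)⁻¹) ^ k < zroot k i := by
  unfold zroot
  have hk : 0 < (k : ℝ) + 1 := by positivity
  have hi : 0 < ((i : ℝ) + 1) / ((k : ℝ) + 1) := by positivity
  nlinarith [four_inv_pow_pos k]

/-- The designed roots of one level increase with the index. -/
theorem zroot_strictMono (k : ℕ) : StrictMono (zroot k) := by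
  intro i j hij
  unfold zroot
  have hk : 0 < (k : ℝ) + 1 := by positivity
  have hij' : (i : ℝ) < (j : ℝ) := by exact_mod_cast hij
  have h4 := four_inv_pow_pos k
  apply mul_lt_mul_of_pos_left _ h4
  have : ((i : ℝ) + 1) / ((k : ℝ) + 1) < ((j : ℝ) + 1) / ((k : ℝ) + 1) :=
    div_lt_div_of_pos_right (by linarith) hk
  linarith

/-- The designed roots of one level are pairwise distinct. -/
theorem zroot_injective (k : ℕ) : Function.Injective (zroot k) := (zroot_strictMono k).injective

/-- Roots of the parent (size `k+1`) lie strictly below the roots of the child (size `k`). -/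
theorem zroot_succ_lt (k : ℕ) (i : Fin (k + 1)) (l : Fin k) : zroot (k + 1) i < zroot k l := by
  have h1 := zroot_lt_two_mul (k + 1) i
  have h2 := gt_of_zroot k l
  have : 2 * ((4 : ℝ)⁻¹) ^ (k + 1) ≤ ((4 : ℝ)⁻¹) ^ k := by
    rw [pow_succ]; nlinarith [four_inv_pow_pos k]
  linarith

/-- Every designed root is `< 5` (so the auxiliary nodes `5, 6` are not roots). -/
theorem zroot_lt_five (k : ℕ) (l : Fin k) : zroot k l < 5 := by
  have h1 := zroot_lt_two_mul k l
  have : ((4 : ℝ)⁻¹) ^ k ≤ 1 := pow_le_one₀ (by norm_num) (by norm_num)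
  linarith

end Windows

section Signs

/-- Sign of `∏_{j ≠ l} (f l − f j)` for a strictly increasing `f : Fin n → ℝ`: it is `(−1)^{n−1−l}` (the factors with `j > l` are
the negative ones). -/
theorem prod_erase_sub_sign {n : ℕ} (f : Fin n → ℝ) (hf : StrictMono f) (l : Fin n) :
    0 < (-1) ^ (n - 1 - (l : ℕ)) * ∏ j ∈ univ.erase l, (f l - f j) := by
  have hsplit : (univ.erase l : Finset (Fin n)) = Finset.Iio l ∪ Finset.Ioi l := by
    ext j
    simp only [mem_erase, ne_eq, mem_univ, and_true, mem_union, Finset.mem_Iio, Finset.mem_Ioi]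
    constructor
    · intro h; exact lt_or_gt_of_ne h
    · rintro (h | h)
      · exact ne_of_lt h
      · exact ne_of_gt h
  have hdisj : Disjoint (Finset.Iio l) (Finset.Ioi l) := by
    rw [Finset.disjoint_left]
    intro j hj hj'
    rw [Finset.mem_Iio] at hj; rw [Finset.mem_Ioi] at hj'
    exact lt_asymm hj hj'
  rw [hsplit, Finset.prod_union hdisj]
  have h1 : 0 < ∏ j ∈ Finset.Iio l, (f l - f j) := by
    apply Finset.prod_pos
    intro j hj; rw [Finset.mem_Iio] at hj; exact sub_pos.mpr (hf hj)
  have h2 : ∏ j ∈ Finset.Ioi l, (f l - f j) = (-1) ^ (n - 1 - (l : ℕ)) * ∏ j ∈ Finset.Ioi l, (f j - f l) := by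
    rw [← Fin.card_Ioi l, ← Finset.prod_neg]
    refine Finset.prod_congr rfl fun j _ => by ring
  have h3 : 0 < ∏ j ∈ Finset.Ioi l, (f j - f l) := by
    apply Finset.prod_pos
    intro j hj; rw [Finset.mem_Ioi] at hj; exact sub_pos.mpr (hf hj)
  rw [h2]
  have h4 : ((-1 : ℝ) ^ (n - 1 - (l : ℕ))) * (-1) ^ (n - 1 - (l : ℕ)) = 1 := by
    rw [← pow_add, ← two_mul, pow_mul]; norm_num
  have h5 : (-1 : ℝ) ^ (n - 1 - (l : ℕ)) * ((∏ j ∈ Finset.Iio l, (f l - f j)) *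
      ((-1) ^ (n - 1 - (l : ℕ)) * ∏ j ∈ Finset.Ioi l, (f j - f l)))
      = ((-1 : ℝ) ^ (n - 1 - (l : ℕ)) * (-1) ^ (n - 1 - (l : ℕ))) *
        ((∏ j ∈ Finset.Iio l, (f l - f j)) * ∏ j ∈ Finset.Ioi l, (f j - f l)) := by ring
  rw [h5, h4, one_mul]
  exact mul_pos h1 h3

/-- All factors positive: `0 < ∏_l (f l − x)` when `x < f l` for all `l`. -/
theorem prod_sub_pos {n : ℕ} (f : Fin n → ℝ) (x : ℝ) (h : ∀ l, x < f l) : 0 < ∏ l, (f l - x) :=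
  Finset.prod_pos fun l _ => sub_pos.mpr (h l)

/-- `∏_l (x − f l) = (−1)^n ∏_l (f l − x)`, hence its sign is `(−1)^n` when `x` is below every `f l`. -/
theorem prod_sub_rev_sign {n : ℕ} (f : Fin n → ℝ) (x : ℝ) (h : ∀ l, x < f l) :
    0 < (-1) ^ n * ∏ l, (x - f l) := by
  have hneg := Finset.prod_neg (s := (univ : Finset (Fin n))) (fun l => f l - x)
  simp only [Finset.card_univ, Fintype.card_fin] at hneg
  have : ∏ l, (x - f l) = (-1) ^ n * ∏ l, (f l - x) := by
    rw [← hneg]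
    exact Finset.prod_congr rfl fun l _ => by ring
  have h4 : ((-1 : ℝ) ^ n) * (-1) ^ n = 1 := by
    rw [← pow_add, ← two_mul, pow_mul]; norm_num
  rw [this, ← mul_assoc, h4, one_mul]
  exact prod_sub_pos f x h

end Signs

section PartialFractions

variable (k : ℕ)

/-- `P(x) = ∏_i (x − zroot (k+1) i)`. -/
theorem eval_Ppoly (x : ℝ) : (Ppoly k).eval x = ∏ i : Fin (k + 1), (x - zroot (k + 1) i) := by
  simp [Ppoly, Polynomial.eval_prod]

/-- `N(x) = ∏_l (x − zroot k l)`. -/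
theorem eval_Npoly (x : ℝ) : (Npoly k).eval x = ∏ l : Fin k, (x - zroot k l) := by
  simp [Npoly, Polynomial.eval_prod]

/-- `N_l(x) = ∏_{j ≠ l} (x − zroot k j)`. -/
theorem eval_Nlpoly (l : Fin k) (x : ℝ) : (Nlpoly k l).eval x = ∏ j ∈ univ.erase l, (x - zroot k j) := by
  simp [Nlpoly, Polynomial.eval_prod]

/-- `L(x) = lconst + lslope·x`. -/
theorem eval_Lpoly (x : ℝ) : (Lpoly k).eval x = lconst k + lslope k * x := by
  simp [Lpoly]

/-- `N = (X − ν_l) · N_l`. -/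
theorem Npoly_eq_mul (l : Fin k) : Npoly k = (X - C (zroot k l)) * Nlpoly k l := by
  unfold Npoly Nlpoly
  exact (Finset.mul_prod_erase (univ : Finset (Fin k)) (fun j => X - C (zroot k j)) (mem_univ l)).symm

/-- `N(x) = (x − ν_l)·N_l(x)`. -/
theorem eval_Npoly_eq_mul (l : Fin k) (x : ℝ) :
    (Npoly k).eval x = (x - zroot k l) * (Nlpoly k l).eval x := by
  rw [Npoly_eq_mul k l]; simp

/-- `N_j(ν_l) = 0` for `j ≠ l`. -/
theorem eval_Nlpoly_root_ne {j l : Fin k} (h : j ≠ l) : (Nlpoly k j).eval (zroot k l) = 0 := by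
  rw [eval_Nlpoly]
  exact Finset.prod_eq_zero (Finset.mem_erase.mpr ⟨h.symm, mem_univ _⟩) (by simp)

/-- `N_l(ν_l) ≠ 0`, with sign `(−1)^{k−1−l}`. -/
theorem eval_Nlpoly_root_sign (l : Fin k) :
    0 < (-1) ^ (k - 1 - (l : ℕ)) * (Nlpoly k l).eval (zroot k l) := by
  rw [eval_Nlpoly]
  exact prod_erase_sub_sign _ (zroot_strictMono k) l

/-- `N_l(ν_l) ≠ 0`. -/
theorem eval_Nlpoly_root_ne_zero (l : Fin k) : (Nlpoly k l).eval (zroot k l) ≠ 0 := by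
  intro h
  have := eval_Nlpoly_root_sign k l
  rw [h, mul_zero] at this
  exact lt_irrefl _ this

/-- `N(ν_l) = 0`. -/
theorem eval_Npoly_root (l : Fin k) : (Npoly k).eval (zroot k l) = 0 := by
  rw [eval_Npoly_eq_mul k l]; simp

/-- `N(x) ≠ 0` off the child's roots. -/
theorem eval_Npoly_ne_zero {x : ℝ} (hx : ∀ l, x ≠ zroot k l) : (Npoly k).eval x ≠ 0 := by
  rw [eval_Npoly]
  exact Finset.prod_ne_zero_iff.mpr fun l _ => sub_ne_zero.mpr (hx l)

/-- `P(ν_l) > 0`: every parent root lies below `ν_l`. -/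
theorem eval_Ppoly_child_root_pos (l : Fin k) : 0 < (Ppoly k).eval (zroot k l) := by
  rw [eval_Ppoly]
  exact Finset.prod_pos fun i _ => sub_pos.mpr (zroot_succ_lt k i l)

/-- `P(z_i) = 0`. -/
theorem eval_Ppoly_root (i : Fin (k + 1)) : (Ppoly k).eval (zroot (k + 1) i) = 0 := by
  rw [eval_Ppoly]
  exact Finset.prod_eq_zero (mem_univ i) (by simp)

/-- `N(z_i)` has sign `(−1)^k`. -/
theorem eval_Npoly_parent_root_sign (i : Fin (k + 1)) :
    0 < (-1) ^ k * (Npoly k).eval (zroot (k + 1) i) := by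
  rw [eval_Npoly]
  exact prod_sub_rev_sign _ _ fun l => zroot_succ_lt k i l

/-- `N(z_i) ≠ 0` at a parent root. -/
theorem eval_Npoly_parent_root_ne_zero (i : Fin (k + 1)) : (Npoly k).eval (zroot (k + 1) i) ≠ 0 :=
  eval_Npoly_ne_zero k fun l => (zroot_succ_lt k i l).ne

/-- `5` is not a child root. -/
theorem five_ne_zroot (l : Fin k) : (5 : ℝ) ≠ zroot k l := (zroot_lt_five k l).ne'

/-- `6` is not a child root. -/
theorem six_ne_zroot (l : Fin k) : (6 : ℝ) ≠ zroot k l := by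
  have := zroot_lt_five k l; intro h; linarith

/-- The linear part takes the designed values at the auxiliary nodes. -/
theorem eval_Lpoly_five : (Lpoly k).eval 5 = lval k 5 := by
  rw [eval_Lpoly]; unfold lconst; ring

/-- `L(6) = lval 6`. -/
theorem eval_Lpoly_six : (Lpoly k).eval 6 = lval k 6 := by
  rw [eval_Lpoly]; unfold lconst lslope; ring

/-- `lval w · N(w) = P(w) − Σ_l r_l N_l(w)` off the roots. -/
theorem lval_mul_Npoly {w : ℝ} (hw : ∀ l, w ≠ zroot k l) :
    lval k w * (Npoly k).eval w = (Ppoly k).eval w - ∑ l, rcoef k l * (Nlpoly k l).eval w := by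
  unfold lval
  rw [div_mul_cancel₀ _ (eval_Npoly_ne_zero k hw)]

/-- Degree bookkeeping: `deg P ≤ k+1`. -/
theorem natDegree_Ppoly_le : (Ppoly k).natDegree ≤ k + 1 := by
  unfold Ppoly
  refine (Polynomial.natDegree_prod_le _ _).trans ?_
  simp

/-- `deg N ≤ k`. -/
theorem natDegree_Npoly_le : (Npoly k).natDegree ≤ k := by
  unfold Npoly
  refine (Polynomial.natDegree_prod_le _ _).trans ?_
  simp

/-- `deg N_l ≤ k`. -/
theorem natDegree_Nlpoly_le (l : Fin k) : (Nlpoly k l).natDegree ≤ k := by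
  unfold Nlpoly
  refine (Polynomial.natDegree_prod_le _ _).trans ?_
  refine (Finset.sum_le_sum (fun j _ => Polynomial.natDegree_X_sub_C_le (zroot k j))).trans ?_
  simp only [Finset.sum_const, smul_eq_mul, mul_one]
  exact (Finset.card_erase_le).trans (by simp)

/-- `deg L ≤ 1`. -/
theorem natDegree_Lpoly_le : (Lpoly k).natDegree ≤ 1 := by
  unfold Lpoly
  rw [add_comm]
  exact Polynomial.natDegree_linear_le

/-- The right-hand side of the partial-fraction identity. -/
theorem natDegree_rhs_le :
    (Lpoly k * Npoly k + ∑ l, C (rcoef k l) * Nlpoly k l).natDegree ≤ k + 1 := by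
  refine (Polynomial.natDegree_add_le _ _).trans (max_le ?_ ?_)
  · refine (Polynomial.natDegree_mul_le).trans ?_
    have := natDegree_Lpoly_le k; have := natDegree_Npoly_le k; omega
  · refine (Polynomial.natDegree_sum_le_of_forall_le _ _ fun l _ => ?_)
    refine (Polynomial.natDegree_C_mul_le _ _).trans ((natDegree_Nlpoly_le k l).trans (by omega))

/-- **Partial fractions, as a polynomial identity**: `P = L·N + Σ_l r_l·N_l`.  Proof: both sides have degree `≤ k+1` and agree
at the `k+2` points `ν_0, …, ν_{k−1}, 5, 6`. -/
theorem Ppoly_eq : Ppoly k = Lpoly k * Npoly k + ∑ l, C (rcoef k l) * Nlpoly k l := by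
  classical
  let f : Fin k ⊕ Bool → ℝ := Sum.elim (zroot k) (fun b => bif b then 6 else 5)
  have hf5 : f (Sum.inr false) = 5 := rfl
  have hf6 : f (Sum.inr true) = 6 := rfl
  have hf : Function.Injective f := by
    rintro (a | a) (b | b) h
    · exact congrArg Sum.inl (zroot_injective k h)
    · exfalso
      cases b
      · rw [hf5] at h; exact five_ne_zroot k a h.symm
      · rw [hf6] at h; exact six_ne_zroot k a h.symm
    · exfalso
      cases a
      · rw [hf5] at h; exact five_ne_zroot k b h
      · rw [hf6] at h; exact six_ne_zroot k b h
    · cases a <;> cases b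
      · rfl
      · exfalso; rw [hf5, hf6] at h; norm_num at h
      · exfalso; rw [hf5, hf6] at h; norm_num at h
      · rfl
  apply Polynomial.eq_of_natDegree_lt_card_of_eval_eq _ _ hf
  · rintro (l | b)
    · -- at a child root `ν_l`
      simp only [f, Sum.elim_inl, Polynomial.eval_add, Polynomial.eval_mul, eval_Npoly_root, mul_zero,
        zero_add, Polynomial.eval_finsetSum, Polynomial.eval_C]
      rw [Finset.sum_eq_single l]
      · unfold rcoef; rw [div_mul_cancel₀ _ (eval_Nlpoly_root_ne_zero k l)]
      · intro j _ hj; rw [eval_Nlpoly_root_ne k hj, mul_zero]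
      · intro h; exact absurd (mem_univ l) h
    · -- at an auxiliary node
      cases b
      · rw [hf5, Polynomial.eval_add, Polynomial.eval_mul, eval_Lpoly_five, lval_mul_Npoly k (five_ne_zroot k)]
        simp [Polynomial.eval_finsetSum]
      · rw [hf6, Polynomial.eval_add, Polynomial.eval_mul, eval_Lpoly_six, lval_mul_Npoly k (six_ne_zroot k)]
        simp [Polynomial.eval_finsetSum]
  · simp only [Fintype.card_sum, Fintype.card_fin, Fintype.card_bool]
    have h1 := natDegree_Ppoly_le k
    have h2 := natDegree_rhs_le k
    exact max_lt (by omega) (by omega)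

/-- Evaluated partial fractions off the child's roots: `P(x) = L(x) N(x) + Σ_l r_l N_l(x)`. -/
theorem eval_Ppoly_eq (x : ℝ) :
    (Ppoly k).eval x = (Lpoly k).eval x * (Npoly k).eval x + ∑ l, rcoef k l * (Nlpoly k l).eval x := by
  conv_lhs => rw [Ppoly_eq k]
  simp [Polynomial.eval_finsetSum]

end PartialFractions

end Summit.ValiantsHypothesis.ValiantsHypothesis.Theorems.LacunarySymmetroidMatrixDescartes.Census.LagrangeTower
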